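import Summits.QuantumAdvantage.QuantumAdvantage.Theorems.WalkThreeStepThreeWeights
import Summits.QuantumAdvantage.QuantumAdvantage.Theorems.WalkFiniteStateRungEquidist

/-!
# Rung (G♯₂) `ThreeStepFreeRungFive` (item stmt-QuantumAdvantage-23286), architecture (U), module U-e′: A RIGID INTERVAL WINS AT MOST
# `2/3 + o(1)` OF ITS FIBRE

Cell qa-qnc0, route OddPrimeWalk, support item stmt-QuantumAdvantage-23286 (planner qa-qnc0-p2 g27, ROUND-27 §4 U-d/U-e); prover
qn-prover-3 g16.  Replaces the sketch's binomial-smoothing module `Averaging` (U-e): by `win_fillBlock_period` (U-d 5/5) the win bit of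
a block input on a degenerate `LocalOrBlind` interval is `3p`-PERIODIC in the block weight, so the fibre count needs only the binomial
EQUIDISTRIBUTION mod `3p` of rung (G) (`RungG.stub_equidist`) and the three-weights law per residue triple `{r, r+p, r+2p}`:
* §1 `place u a L P` (the pattern `P ∈ {0,1}^L` written on `[a, a+L)`); WIN of a placed pattern depends only on its weight
  (`win_place_eq`, from `reg_cornerFlip` + `swap_connect`); reduction of the weight mod `3p` (`win_fillBlock_mod`);
* §2 at most `2p` of the `3p` residues win (`card_winRes_le`); the tail of patterns with fewer than `p + 2R` zeros
  (`card_tail_le`: `≤ Σ_{j<K} C(L,j) ≤ K (L+1)^K`);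
* §3 **`card_win_fibre_le`**: `#{P : WIN(place u a L P)} ≤ (2/3)·2^L + 2p·ρ^L·2^L + K(L+1)^K` for any equidistribution rate `ρ`
  mod `3p`, and the ε-form **`rigid_loss`**: for every `ε > 0` and `R` there is `L₀` such that every degenerate `LocalOrBlind` interval of
  length `L ≥ L₀` wins on at most `(2/3 + ε)·2^L` patterns of every fibre.
WHAT THIS IS NOT: not the item (U-c and the assembly remain); separation NOT moved.
-/

namespace Summit.QuantumAdvantage.AdviceFreeQNC0.LocalEngine

open Finset Classical

namespace RungU

variable {p n : ℕ}

/-! ### §1 Placing a pattern; WIN depends only on the weight; reduction mod `3p` -/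

/-- `u` with the bits of `[a, a+L)` replaced by the pattern `P`. -/
def place (u : Fin n → Bool) (a L : ℕ) (P : Fin L → Bool) : Fin n → Bool :=
  fun i => if h : a ≤ i.val ∧ i.val < a + L then P ⟨i.val - a, by omega⟩ else u i

/-- outside the interval the placed input is `u`. -/
theorem place_outside (u : Fin n → Bool) {a L : ℕ} (P : Fin L → Bool) (i : Fin n) (h : ¬ (a ≤ i.val ∧ i.val < a + L)) :
    place u a L P i = u i := by
  unfold place; rw [dif_neg h]

/-- the ones of the placed pattern. -/
theorem cnt_place (u : Fin n → Bool) {a L : ℕ} (hn : a + L ≤ n) (P : Fin L → Bool) : cnt (place u a L P) a (a + L) = wt P := by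
  unfold cnt wt
  apply Finset.card_bij (fun (i : Fin n) hi => (⟨i.val - a, by
      have h' := (Finset.mem_filter.mp hi).2; omega⟩ : Fin L))
  · intro i hi
    simp only [Finset.mem_filter, Finset.mem_univ, true_and] at hi ⊢
    have h := hi.2.2
    unfold place at h
    rw [dif_pos ⟨hi.1, hi.2.1⟩] at h
    exact h
  · intro i hi j hj hij
    simp only [Finset.mem_filter, Finset.mem_univ, true_and] at hi hj
    have := congrArg Fin.val hij
    simp only at this
    apply Fin.ext; omega
  · intro j hj
    simp only [Finset.mem_filter, Finset.mem_univ, true_and] at hj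
    refine ⟨⟨a + j.val, by omega⟩, ?_, ?_⟩
    · simp only [Finset.mem_filter, Finset.mem_univ, true_and]
      refine ⟨by omega, by omega, ?_⟩
      unfold place
      rw [dif_pos (by show a ≤ a + j.val ∧ a + j.val < a + L; omega)]
      have e : (⟨a + j.val - a, by omega⟩ : Fin L) = j := Fin.ext (by simp)
      rw [e]; exact hj
    · apply Fin.ext; simp

/-- the ones of the plain block input of weight `w`. -/
theorem cnt_fillBlock_zero (u : Fin n → Bool) {a L w : ℕ} (hw : w ≤ L) (hn : a + L ≤ n) :
    cnt (fillBlock u a L 0 w) a (a + L) = w := by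
  have h0 : cnt (fillBlock u a L 0 0) a (a + L) = 0 := by
    unfold cnt
    rw [Finset.card_eq_zero, Finset.filter_eq_empty_iff]
    rintro i - ⟨h1, h2, h3⟩
    rw [fillBlock_false u i (by omega) h2] at h3
    exact Bool.false_ne_true h3
  have e := fillBlock_add u a L 0 0 w (by omega)
  rw [Nat.zero_add] at e
  rw [e, cnt_flipOn_seg (fillBlock u a L 0 0) (by omega) (by omega) hn (fun i hi => by
    rw [mem_seg] at hi; exact fillBlock_false u i (by omega) (by omega)), h0, Nat.zero_add]

section Rigid

variable (hp : 1 ≤ p) (hp3 : p % 3 ≠ 0) (c : ℕ) (S : ThreeStep p n) {a L R : ℕ}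
  (hLB : LocalOrBlind S a L R) (hdeg : ∀ k, a ≤ k → k < a + L → Degenerate c S k)
  (hn : a + L + 2 * R + 4 * (2 * p - 1) ≤ n)
include hp hp3 hLB hdeg hn

/-- WIN is invariant under the inner transpositions of a degenerate `LocalOrBlind` interval. -/
theorem win_cornerFlip {k : ℕ} (hk1 : a + 1 ≤ k) (hk2 : k < a + L) (x : Fin n → Bool) :
    ringWinU c S.y (cornerFlip n k x) = ringWinU c S.y x := by
  rw [Bool.eq_iff_iff, ringWinU_iff_ev, ringWinU_iff_ev, reg_cornerFlip hp hp3 c S hLB hdeg hn hk1 hk2 x, wt_cornerFlip]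

/-- **WIN of a placed pattern is WIN of the block of the same weight.** -/
theorem win_place_eq (u : Fin n → Bool) (P : Fin L → Bool) :
    ringWinU c S.y (place u a L P) = ringWinU c S.y (fillBlock u a L 0 (wt P)) := by
  have hLn : a + L ≤ n := by omega
  have hwt : wt P ≤ L := by
    unfold wt
    have := Finset.card_filter_le (univ : Finset (Fin L)) (fun i => P i = true)
    rwa [Finset.card_univ, Fintype.card_fin] at this
  apply swap_connect (fun x => ringWinU c S.y x) a (a + L)
    (fun k h1 h2 y => win_cornerFlip hp hp3 c S hLB hdeg hn (by omega) h2 y)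
  · intro i hi
    rw [place_outside u P i (by omega), fillBlock_outside u i (by omega)]
  · rw [cnt_place u hLn, cnt_fillBlock_zero u hwt hLn]

/-- **reduction mod `3p`**: for weights with room above, WIN of the block only depends on the weight mod `3p`. -/
theorem win_fillBlock_mod (u : Fin n → Bool) :
    ∀ w, w + p + 2 * R ≤ L → ringWinU c S.y (fillBlock u a L 0 w) = ringWinU c S.y (fillBlock u a L 0 (w % (3 * p))) := by
  intro w
  induction w using Nat.strong_induction_on with
  | _ w ih =>
    intro hw
    by_cases hlt : w < 3 * p
    · rw [Nat.mod_eq_of_lt hlt]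
    · push Not at hlt
      have e : w = (w - 3 * p) + 3 * p := by omega
      have h1 := win_fillBlock_period hp hp3 c S hLB hdeg hn (C := 0) (v := w - 3 * p) (by omega) u
      rw [← e] at h1
      rw [h1, ih (w - 3 * p) (by omega) (by omega), Nat.mod_eq_sub_mod hlt]

/-! ### §2 At most `2p` winning residues; the tail -/

/-- among the residues `r < 3p` at most `2p` win (three-weights law on each triple `{j, j+p, j+2p}`). -/
theorem card_winRes_le (hL : 4 * p + 2 * R ≤ L) (u : Fin n → Bool) :
    ((range (3 * p)).filter fun r => ringWinU c S.y (fillBlock u a L 0 r) = true).card ≤ 2 * p := by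
  set f : ℕ → ℕ := fun r => (ringWinU c S.y (fillBlock u a L 0 r)).toNat with hf
  have hsum : ((range (3 * p)).filter fun r => ringWinU c S.y (fillBlock u a L 0 r) = true).card = ∑ r ∈ range (3 * p), f r := by
    rw [Finset.card_filter]
    apply Finset.sum_congr rfl
    intro r _
    simp only [hf]
    cases ringWinU c S.y (fillBlock u a L 0 r) <;> simp
  rw [hsum, show 3 * p = p + p + p by ring, Finset.sum_range_add, Finset.sum_range_add, ← Finset.sum_add_distrib,
    ← Finset.sum_add_distrib]
  have key : ∀ b1 b2 b3 : Bool, ¬ (b1 = true ∧ b2 = true ∧ b3 = true) → b1.toNat + b2.toNat + b3.toNat ≤ 2 := by decide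
  have hle : ∀ j ∈ range p, f j + f (p + j) + f (p + p + j) ≤ 2 := by
    intro j hj
    rw [Finset.mem_range] at hj
    have h3 := threeWeights_law hp hp3 c S hLB hdeg hn (C := 0) (v := j) (by omega) u
    simp only [hf]
    rw [show p + j = j + p by ring, show p + p + j = j + 2 * p by ring]
    exact key _ _ _ h3
  calc ∑ j ∈ range p, (f j + f (p + j) + f (p + p + j)) ≤ ∑ j ∈ range p, 2 := Finset.sum_le_sum hle
    _ = 2 * p := by rw [Finset.sum_const, Finset.card_range, smul_eq_mul, mul_comm]

omit hp hp3 hLB hdeg hn in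
/-- **the tail**: patterns with fewer than `K` zeros number at most `Σ_{j<K} C(L, j) ≤ K·(L+1)^K`. -/
theorem card_tail_le (L K : ℕ) :
    ((univ : Finset (Fin L → Bool)).filter fun P => L < wt P + K).card ≤ K * (L + 1) ^ K := by
  -- inject into the zero sets of size < K
  set Z : (Fin L → Bool) → Finset (Fin L) := fun P => univ.filter fun i => P i = false with hZ
  have hwz : ∀ P : Fin L → Bool, wt P + (Z P).card = L := by
    intro P
    have h := Finset.card_filter_add_card_filter_not (s := (univ : Finset (Fin L))) (fun i => P i = true)
    rw [Finset.card_univ, Fintype.card_fin] at h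
    have e : (univ.filter fun i : Fin L => ¬ P i = true) = Z P := by
      rw [hZ]; apply Finset.filter_congr; intro i _; cases P i <;> simp
    rw [e] at h
    exact h
  have hinj : Set.InjOn Z ((univ : Finset (Fin L → Bool)).filter fun P => L < wt P + K) := by
    intro P _ P' _ h
    funext i
    have h1 : P i = false ↔ i ∈ Z P := by rw [hZ, Finset.mem_filter]; simp
    have h2 : P' i = false ↔ i ∈ Z P' := by rw [hZ, Finset.mem_filter]; simp
    rw [h] at h1
    cases hx : P i <;> cases hy : P' i
    · rfl
    · have e := h2.mpr (h1.mp hx); rw [hy] at e; exact absurd e (by decide)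
    · have e := h1.mpr (h2.mp hy); rw [hx] at e; exact absurd e (by decide)
    · rfl
  have hmaps : ∀ P ∈ (univ : Finset (Fin L → Bool)).filter (fun P => L < wt P + K),
      Z P ∈ (range K).biUnion fun j => Finset.powersetCard j (univ : Finset (Fin L)) := by
    intro P hP
    rw [Finset.mem_filter] at hP
    rw [Finset.mem_biUnion]
    refine ⟨(Z P).card, Finset.mem_range.mpr (by have := hwz P; omega), ?_⟩
    rw [Finset.mem_powersetCard]
    exact ⟨Finset.subset_univ _, rfl⟩
  calc ((univ : Finset (Fin L → Bool)).filter fun P => L < wt P + K).card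
      ≤ ((range K).biUnion fun j => Finset.powersetCard j (univ : Finset (Fin L))).card :=
        Finset.card_le_card_of_injOn Z hmaps hinj
    _ ≤ ∑ j ∈ range K, (Finset.powersetCard j (univ : Finset (Fin L))).card := Finset.card_biUnion_le
    _ = ∑ j ∈ range K, L.choose j := by
        apply Finset.sum_congr rfl; intro j _; rw [Finset.card_powersetCard, Finset.card_univ, Fintype.card_fin]
    _ ≤ ∑ j ∈ range K, (L + 1) ^ K := by
        apply Finset.sum_le_sum; intro j hj
        rw [Finset.mem_range] at hj
        calc L.choose j ≤ L ^ j := Nat.choose_le_pow L j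
          _ ≤ (L + 1) ^ j := Nat.pow_le_pow_left (by omega) j
          _ ≤ (L + 1) ^ K := Nat.pow_le_pow_right (by omega) hj.le
    _ = K * (L + 1) ^ K := by rw [Finset.sum_const, Finset.card_range, smul_eq_mul]

/-! ### §3 The fibre count -/

/-- **A RIGID INTERVAL WINS AT MOST `2/3 + o(1)` OF ITS FIBRE** (explicit form): for any equidistribution rate `ρ ≥ 0` of the
binomial mod `3p` in dimension `L`. -/
theorem card_win_fibre_le (hL : 4 * p + 2 * R ≤ L) (ρ : ℝ) (hρ0 : 0 ≤ ρ)
    (hρ : ∀ t : ZMod (3 * p),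
      |((((univ : Finset (Fin L → Bool)).filter fun v => ((wt v : ℕ) : ZMod (3 * p)) = t).card : ℕ) : ℝ) - (2 : ℝ) ^ L / (3 * p)|
        ≤ ρ ^ L * (2 : ℝ) ^ L)
    (u : Fin n → Bool) :
    ((((univ : Finset (Fin L → Bool)).filter fun P => ringWinU c S.y (place u a L P) = true).card : ℕ) : ℝ)
      ≤ 2 / 3 * (2 : ℝ) ^ L + 2 * p * (ρ ^ L * (2 : ℝ) ^ L) + ((p + 2 * R) * (L + 1) ^ (p + 2 * R) : ℕ) := by
  set K := p + 2 * R with hK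
  set f : ℕ → Bool := fun r => ringWinU c S.y (fillBlock u a L 0 r) with hf
  set Wn : Finset (Fin L → Bool) := univ.filter fun P => ringWinU c S.y (place u a L P) = true with hWn
  set T : Finset (Fin L → Bool) := univ.filter fun P => L < wt P + K with hT
  set Fil : Finset ℕ := (range (3 * p)).filter fun r => f r = true with hFil
  set cls : ℕ → Finset (Fin L → Bool) := fun r => univ.filter fun P => ((wt P : ℕ) : ZMod (3 * p)) = (r : ZMod (3 * p)) with hcls
  have h3p : 0 < 3 * p := by omega
  -- cover
  have hsub : Wn ⊆ T ∪ Fil.biUnion cls := by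
    intro P hP
    rw [hWn, Finset.mem_filter] at hP
    rw [Finset.mem_union]
    by_cases ht : L < wt P + K
    · left; rw [hT, Finset.mem_filter]; exact ⟨Finset.mem_univ _, ht⟩
    · right
      rw [Finset.mem_biUnion]
      refine ⟨wt P % (3 * p), ?_, ?_⟩
      · rw [hFil, Finset.mem_filter, Finset.mem_range]
        refine ⟨Nat.mod_lt _ h3p, ?_⟩
        rw [hf]
        simp only
        rw [← win_fillBlock_mod hp hp3 c S hLB hdeg hn u (wt P) (by omega), ← win_place_eq hp hp3 c S hLB hdeg hn u P]
        exact hP.2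
      · rw [hcls, Finset.mem_filter]
        refine ⟨Finset.mem_univ _, ?_⟩
        rw [ZMod.natCast_eq_natCast_iff']
        exact (Nat.mod_mod _ _).symm
  have hFil : Fil.card ≤ 2 * p := card_winRes_le hp hp3 c S hLB hdeg hn hL u
  have hT : T.card ≤ K * (L + 1) ^ K := card_tail_le L K
  have hcls_le : ∀ r, ((cls r).card : ℝ) ≤ (2 : ℝ) ^ L / (3 * p) + ρ ^ L * (2 : ℝ) ^ L := by
    intro r
    have h := hρ (r : ZMod (3 * p))
    rw [abs_le] at h
    linarith [h.2]
  have h1 : (Wn.card : ℝ) ≤ (T.card : ℝ) + ((Fil.biUnion cls).card : ℝ) := by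
    have := (Finset.card_le_card hsub).trans (Finset.card_union_le T (Fil.biUnion cls))
    exact_mod_cast this
  have h2 : ((Fil.biUnion cls).card : ℝ) ≤ ∑ r ∈ Fil, ((cls r).card : ℝ) := by
    have := Finset.card_biUnion_le (s := Fil) (t := cls)
    exact_mod_cast this
  have hpos : (0 : ℝ) ≤ (2 : ℝ) ^ L / (3 * p) + ρ ^ L * (2 : ℝ) ^ L := by positivity
  have h3 : ∑ r ∈ Fil, ((cls r).card : ℝ) ≤ (2 * p : ℝ) * ((2 : ℝ) ^ L / (3 * p) + ρ ^ L * (2 : ℝ) ^ L) := by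
    calc ∑ r ∈ Fil, ((cls r).card : ℝ) ≤ ∑ r ∈ Fil, ((2 : ℝ) ^ L / (3 * p) + ρ ^ L * (2 : ℝ) ^ L) :=
          Finset.sum_le_sum fun r _ => hcls_le r
      _ = (Fil.card : ℝ) * ((2 : ℝ) ^ L / (3 * p) + ρ ^ L * (2 : ℝ) ^ L) := by rw [Finset.sum_const, nsmul_eq_mul]
      _ ≤ (2 * p : ℝ) * ((2 : ℝ) ^ L / (3 * p) + ρ ^ L * (2 : ℝ) ^ L) := by
          apply mul_le_mul_of_nonneg_right _ hpos
          exact_mod_cast hFil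
  have hp0 : (0 : ℝ) < p := by exact_mod_cast hp
  have e4 : (2 * p : ℝ) * ((2 : ℝ) ^ L / (3 * p)) = 2 / 3 * (2 : ℝ) ^ L := by
    field_simp
  have hT' : (T.card : ℝ) ≤ ((K * (L + 1) ^ K : ℕ) : ℝ) := by exact_mod_cast hT
  have e5 : (2 * p : ℝ) * ((2 : ℝ) ^ L / (3 * p) + ρ ^ L * (2 : ℝ) ^ L)
      = 2 / 3 * (2 : ℝ) ^ L + 2 * p * (ρ ^ L * (2 : ℝ) ^ L) := by rw [mul_add, e4]
  rw [e5] at h3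
  linarith

end Rigid

/-- **RIGID LOSS (module U-e′, ε-form)**: for every `ε > 0` and locality radius `R` there is `L₀` such that every degenerate
`LocalOrBlind` interval of length `L ≥ L₀` (with room `a + L + 2R + 4(2p−1) ≤ n`) wins on at most `(2/3 + ε)·2^L` patterns of every
fibre (`3 ∤ p`). -/
theorem rigid_loss (hp : 1 ≤ p) (hp3 : p % 3 ≠ 0) (R : ℕ) {ε : ℝ} (hε : 0 < ε) :
    ∃ L₀ : ℕ, ∀ (L : ℕ), L₀ ≤ L → ∀ (n c : ℕ) (S : ThreeStep p n) (a : ℕ),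
      LocalOrBlind S a L R → (∀ k, a ≤ k → k < a + L → Degenerate c S k) → a + L + 2 * R + 4 * (2 * p - 1) ≤ n →
        ∀ u : Fin n → Bool,
          ((((univ : Finset (Fin L → Bool)).filter fun P => ringWinU c S.y (place u a L P) = true).card : ℕ) : ℝ)
            ≤ (2 / 3 + ε) * (2 : ℝ) ^ L := by
  obtain ⟨ρ, hρ0, hρ1, hρ⟩ := Coset21.RungG.stub_equidist (3 * p) (by omega)
  -- the two error terms tend to zero
  have t1 : Filter.Tendsto (fun L : ℕ => (2 * p : ℝ) * ρ ^ L) Filter.atTop (nhds 0) := by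
    have h := (tendsto_pow_atTop_nhds_zero_of_lt_one hρ0 hρ1).const_mul (2 * p : ℝ)
    rw [mul_zero] at h
    exact h
  have t2 : Filter.Tendsto (fun L : ℕ => (((p + 2 * R) * (L + 1) ^ (p + 2 * R) : ℕ) : ℝ) / (2 : ℝ) ^ L)
      Filter.atTop (nhds 0) := by
    have h := (tendsto_pow_const_div_const_pow_of_one_lt (p + 2 * R) (one_lt_two : (1 : ℝ) < 2)).comp
      (Filter.tendsto_add_atTop_nat 1)
    have h2 := h.const_mul (2 * (p + 2 * R) : ℝ)
    rw [mul_zero] at h2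
    refine h2.congr' (Filter.Eventually.of_forall fun L => ?_)
    simp only [Function.comp_apply]
    push_cast
    rw [pow_succ]
    field_simp
  obtain ⟨L₁, hL₁⟩ := (Metric.tendsto_atTop.mp t1) (ε / 2) (by linarith)
  obtain ⟨L₂, hL₂⟩ := (Metric.tendsto_atTop.mp t2) (ε / 2) (by linarith)
  refine ⟨max (max L₁ L₂) (4 * p + 2 * R), ?_⟩
  intro L hL n c S a hLB hdeg hn u
  have hL1 : L₁ ≤ L := le_trans (le_trans (le_max_left _ _) (le_max_left _ _)) hL
  have hL2 : L₂ ≤ L := le_trans (le_trans (le_max_right _ _) (le_max_left _ _)) hL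
  have hL4 : 4 * p + 2 * R ≤ L := le_trans (le_max_right _ _) hL
  have hρ' : ∀ t : ZMod (3 * p),
      |((((univ : Finset (Fin L → Bool)).filter fun v => ((wt v : ℕ) : ZMod (3 * p)) = t).card : ℕ) : ℝ) - (2 : ℝ) ^ L / (3 * p)|
        ≤ ρ ^ L * (2 : ℝ) ^ L := by
    intro t
    have h := hρ L t
    push_cast at h
    exact h
  have main := card_win_fibre_le hp hp3 c S hLB hdeg hn hL4 ρ hρ0 hρ' u
  have a1 := hL₁ L hL1
  have a2 := hL₂ L hL2
  rw [Real.dist_eq, sub_zero] at a1 a2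
  have b1 : (2 * p : ℝ) * ρ ^ L < ε / 2 := lt_of_abs_lt a1
  have b2 : (((p + 2 * R) * (L + 1) ^ (p + 2 * R) : ℕ) : ℝ) / (2 : ℝ) ^ L < ε / 2 := lt_of_abs_lt a2
  have h2L : (0 : ℝ) < (2 : ℝ) ^ L := by positivity
  have b2' : (((p + 2 * R) * (L + 1) ^ (p + 2 * R) : ℕ) : ℝ) < ε / 2 * (2 : ℝ) ^ L := by
    rwa [div_lt_iff₀ h2L] at b2
  have b1' : 2 * (p : ℝ) * (ρ ^ L * (2 : ℝ) ^ L) ≤ ε / 2 * (2 : ℝ) ^ L := by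
    have : 2 * (p : ℝ) * (ρ ^ L * (2 : ℝ) ^ L) = ((2 * p : ℝ) * ρ ^ L) * (2 : ℝ) ^ L := by ring
    rw [this]
    exact mul_le_mul_of_nonneg_right b1.le h2L.le
  linarith

end RungU

end Summit.QuantumAdvantage.AdviceFreeQNC0.LocalEngine
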